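import Summits.CriticalPhenomena.PercolationContinuityZ3.Theorems.PercNearOneGluingNoHeavyLowerTailKnQuestion8CoefficientwiseNoCoreAdjPoint
import Summits.CriticalPhenomena.PercolationContinuityZ3.Theorems.PercNearOneGluingNoHeavyLowerTailKnQuestion8CoefficientwiseQmixStarClass
import Summits.CriticalPhenomena.PercolationContinuityZ3.Theorems.PercNearOneGluingNoHeavyLowerTailKnQuestion8CoefficientwisePendantEdge
import HarnessLib

/-!
# The point-edge identity: `NO-CORE^G(y)[1_u,g]` resolved at an edge `e = up` of the point — prim-lf-2 gen 53 (part 8)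

Support file (`--supports stmt-CriticalPhenomena-4575`, closed), prover `prim-lf-2` (gen 53).  No definitions, no named facts, no sorries; standard axioms.
Memo `prim-lf-2/CW-SERIES-gen53.md` §9 (CONJECTURE PEM = point-edge monotonicity; part 7 `…CoefficientwisePointEdgeReduction.lean`: PEM ⟹ CONJECTURE NO-CORE at every point).

Setting.  Finite multigraph `ends : ι → Sym2 V`, root `x`, `K(s) = C_x(s)`; `NO-CORE(y)[1_u,g] = Σ_{s : ¬(y ∈ K s ∧ y ∈ K sᶜ)} ([u ∈ K s] − [u ∈ K sᶜ])(g(K s) − g(K sᶜ))`.  Let `e` be an edge with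
ends `{u, p}`, `u ≠ p` (any `u, p`; for PEM `u` is the point and `p ∉ {x, y}`).  On `G − e` (edge type `{j // j ∉ {e}}`, clusters `K′ = C_x`, `U′ = C_u`, `P′ = C_p`):
* `mem_openCluster_insert_edge_iff` — for EVERY `T`: `C_x(T ∪ {e}) = C_x(T) ∪ [u ∈ C_x T ∨ p ∈ C_x T]·(C_u T ∪ C_p T)` (closed-set principle; generalises part 3's root-edge case `p = x`);
* `noCore_pointEdge_eq` — **`NO-CORE^G(y)[1_u,g] = 2·Σ_{r} [y ∉ K⁺r ∩ K′rᶜ]·([u ∈ K⁺r] − [u ∈ K′rᶜ])·(g(K⁺r) − g(K′rᶜ))`** over the colourings `r` of `G − e`, where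
  `K⁺r = K′r ∪ (if u ∈ K′r ∨ p ∈ K′r then U′r ∪ P′r else ∅)` is the red cluster of `x` after adding `e` red (the `e`-blue class is the swap image — `noCore_split_edge`).
With `NO-CORE^{G−e}(y)[1_u,g] = Σ_r [y ∉ K′r ∩ K′rᶜ]([u ∈ K′r] − [u ∈ K′rᶜ])(g(K′r) − g(K′rᶜ))` on the same cube this is the starting identity for CONJECTURE PEM
(`NO-CORE^{G−e} ≤ NO-CORE^G` for `p ∉ {x,y}`; exact census prim-lf-2 gen 53: 0 exceptions on all graphs with ≤ 7 vertices (kit j212999/j213000) and on the LOBE family to (5,5); anatomy memo §9.3).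
[cite: KozmaNitzan2024, Questions 8–9 (§5.5 p. 36) (context: the Question-8 pocket covariance programme)]
-/

namespace Summit.CriticalPhenomena.PercolationContinuityZ3.Theorems

open Finset Literature.Probability.Percolation

namespace Coefficientwise

variable {ι V : Type*} [Fintype ι] [DecidableEq ι] (ends : ι → Sym2 V) (x : V)

omit [Fintype ι] in
/-- **Adding one edge `e = {a, b}` to a colouring:** for every `T`, `v ∈ C_x(T ∪ {e}) ↔ v ∈ C_x(T) ∨ ((a ∈ C_x T ∨ b ∈ C_x T) ∧ (v ∈ C_a T ∨ v ∈ C_b T))`.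
[cite: KozmaNitzan2024, §5.5 (context only; folklore)] -/
theorem mem_openCluster_insert_edge_iff (T : Finset ι) {a b : V} {e : ι} (he : ends e = s(a, b)) (hab : a ≠ b) (v : V) :
    v ∈ openCluster (ends '' (↑(insert e T) : Set ι)) x ↔
      (v ∈ openCluster (ends '' (↑T : Set ι)) x ∨
        ((a ∈ openCluster (ends '' (↑T : Set ι)) x ∨ b ∈ openCluster (ends '' (↑T : Set ι)) x) ∧
          (v ∈ openCluster (ends '' (↑T : Set ι)) a ∨ v ∈ openCluster (ends '' (↑T : Set ι)) b))) := by
  classical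
  constructor
  · intro hv
    set W : Set V := {w | w ∈ openCluster (ends '' (↑T : Set ι)) x ∨
        ((a ∈ openCluster (ends '' (↑T : Set ι)) x ∨ b ∈ openCluster (ends '' (↑T : Set ι)) x) ∧
          (w ∈ openCluster (ends '' (↑T : Set ι)) a ∨ w ∈ openCluster (ends '' (↑T : Set ι)) b))} with hW
    have hxW : x ∈ W := Or.inl (mem_openCluster_self _ x)
    have hcl : ∀ c ∈ W, ∀ d, (openGraph (ends '' (↑(insert e T) : Set ι))).Adj c d → d ∈ W := by
      intro c hc d hcd
      rw [openGraph_image_adj] at hcd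
      obtain ⟨⟨i, hi, hicd⟩, hne⟩ := hcd
      rcases Finset.mem_insert.mp hi with rfl | hiT
      · -- the new edge: {c,d} = {a,b}
        have hcd' : s(c, d) = s(a, b) := by rw [← hicd, he]
        -- c is a or b, d is the other; c ∈ W gives a ∈ C_x T ∨ b ∈ C_x T via c
        have hcx : a ∈ openCluster (ends '' (↑T : Set ι)) x ∨ b ∈ openCluster (ends '' (↑T : Set ι)) x := by
          rcases hc with hc | hc
          · rcases Sym2.eq_iff.mp hcd' with ⟨hca, _⟩ | ⟨hcb, _⟩
            · exact Or.inl (hca ▸ hc)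
            · exact Or.inr (hcb ▸ hc)
          · exact hc.1
        rcases Sym2.eq_iff.mp hcd' with ⟨_, hdb⟩ | ⟨_, hda⟩
        · rw [hdb]; exact Or.inr ⟨hcx, Or.inr (mem_openCluster_self _ _)⟩
        · rw [hda]; exact Or.inr ⟨hcx, Or.inl (mem_openCluster_self _ _)⟩
      · have hadj : (openGraph (ends '' (↑T : Set ι))).Adj c d := by
          rw [openGraph_image_adj]; exact ⟨⟨i, hiT, hicd⟩, hne⟩
        rcases hc with hc | ⟨hab', hc⟩
        · exact Or.inl (SimpleGraph.Reachable.trans hc hadj.reachable)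
        · rcases hc with hc | hc
          · exact Or.inr ⟨hab', Or.inl (SimpleGraph.Reachable.trans hc hadj.reachable)⟩
          · exact Or.inr ⟨hab', Or.inr (SimpleGraph.Reachable.trans hc hadj.reachable)⟩
    exact openCluster_subset_of_adjClosed ends x (↑(insert e T) : Set ι) W hxW hcl hv
  · intro hv
    have hmono : ∀ w : V, openCluster (ends '' (↑T : Set ι)) w ⊆ openCluster (ends '' (↑(insert e T) : Set ι)) w :=
      fun w => openCluster_image_mono ends (Finset.subset_insert e T) w
    have hab_adj : (openGraph (ends '' (↑(insert e T) : Set ι))).Adj a b := by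
      rw [openGraph_image_adj]
      exact ⟨⟨e, Finset.mem_insert_self e T, he⟩, hab⟩
    rcases hv with hv | ⟨hx', hv⟩
    · exact hmono x hv
    · -- x reaches a or b in T, hence both in T ∪ {e}; then a or b reaches v
      have hxa : a ∈ openCluster (ends '' (↑(insert e T) : Set ι)) x := by
        rcases hx' with h | h
        · exact hmono x h
        · exact SimpleGraph.Reachable.trans (hmono x h) hab_adj.symm.reachable
      have hxb : b ∈ openCluster (ends '' (↑(insert e T) : Set ι)) x := SimpleGraph.Reachable.trans hxa hab_adj.reachable
      rcases hv with h | h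
      · exact SimpleGraph.Reachable.trans hxa (hmono a h)
      · exact SimpleGraph.Reachable.trans hxb (hmono b h)

section pointEdge

variable {u p y : V} {e : ι} (g : Set V → ℝ)

open Classical in
/-- **The point-edge identity (prim-lf-2 gen 53).**  Let `e` have ends `{u, p}`, `u ≠ p`.  Then for every vertex `y` and every `g`,
`NO-CORE(y)[1_u,g] = 2·Σ_r [y ∉ K⁺r ∩ K′rᶜ]·([u ∈ K⁺r] − [u ∈ K′rᶜ])·(g(K⁺r) − g(K′rᶜ))` over the cube of `G − e` (edge type `{j // j ∉ {e}}`, `K′ = C_x`, `U′ = C_u`, `P′ = C_p`,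
`K⁺r = K′r ∪ (if u ∈ K′r ∨ p ∈ K′r then U′r ∪ P′r else ∅)`).  No hypothesis on the other edges, none on `g`.  [cite: KozmaNitzan2024, Questions 8–9 (§5.5 p. 36) (context)] -/
theorem noCore_pointEdge_eq (he : ends e = s(u, p)) (hup : u ≠ p) (y : V) :
    ∑ s ∈ univ.filter (fun s : Finset ι => ¬ (y ∈ openCluster (ends '' (↑s : Set ι)) x ∧ y ∈ openCluster (ends '' (↑(sᶜ) : Set ι)) x)),
      ((if u ∈ openCluster (ends '' (↑s : Set ι)) x then (1 : ℝ) else 0) - (if u ∈ openCluster (ends '' (↑(sᶜ) : Set ι)) x then (1 : ℝ) else 0)) *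
        (g (openCluster (ends '' (↑s : Set ι)) x) - g (openCluster (ends '' (↑(sᶜ) : Set ι)) x)) =
    2 * ∑ r : Finset {j : ι // j ∉ ({e} : Finset ι)},
      (if ¬ (y ∈ (openCluster ((fun j : {j : ι // j ∉ ({e} : Finset ι)} => ends j.1) '' (↑r : Set {j : ι // j ∉ ({e} : Finset ι)})) x ∪
                  (if (u ∈ openCluster ((fun j : {j : ι // j ∉ ({e} : Finset ι)} => ends j.1) '' (↑r : Set {j : ι // j ∉ ({e} : Finset ι)})) x ∨
                       p ∈ openCluster ((fun j : {j : ι // j ∉ ({e} : Finset ι)} => ends j.1) '' (↑r : Set {j : ι // j ∉ ({e} : Finset ι)})) x)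
                   then (openCluster ((fun j : {j : ι // j ∉ ({e} : Finset ι)} => ends j.1) '' (↑r : Set {j : ι // j ∉ ({e} : Finset ι)})) u ∪
                         openCluster ((fun j : {j : ι // j ∉ ({e} : Finset ι)} => ends j.1) '' (↑r : Set {j : ι // j ∉ ({e} : Finset ι)})) p)
                   else (∅ : Set V))) ∧
              y ∈ openCluster ((fun j : {j : ι // j ∉ ({e} : Finset ι)} => ends j.1) '' (↑(rᶜ) : Set {j : ι // j ∉ ({e} : Finset ι)})) x) then
        (((if u ∈ (openCluster ((fun j : {j : ι // j ∉ ({e} : Finset ι)} => ends j.1) '' (↑r : Set {j : ι // j ∉ ({e} : Finset ι)})) x ∪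
                  (if (u ∈ openCluster ((fun j : {j : ι // j ∉ ({e} : Finset ι)} => ends j.1) '' (↑r : Set {j : ι // j ∉ ({e} : Finset ι)})) x ∨
                       p ∈ openCluster ((fun j : {j : ι // j ∉ ({e} : Finset ι)} => ends j.1) '' (↑r : Set {j : ι // j ∉ ({e} : Finset ι)})) x)
                   then (openCluster ((fun j : {j : ι // j ∉ ({e} : Finset ι)} => ends j.1) '' (↑r : Set {j : ι // j ∉ ({e} : Finset ι)})) u ∪
                         openCluster ((fun j : {j : ι // j ∉ ({e} : Finset ι)} => ends j.1) '' (↑r : Set {j : ι // j ∉ ({e} : Finset ι)})) p)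
                   else (∅ : Set V))) then (1 : ℝ) else 0) -
          (if u ∈ openCluster ((fun j : {j : ι // j ∉ ({e} : Finset ι)} => ends j.1) '' (↑(rᶜ) : Set {j : ι // j ∉ ({e} : Finset ι)})) x then (1 : ℝ) else 0)) *
        (g (openCluster ((fun j : {j : ι // j ∉ ({e} : Finset ι)} => ends j.1) '' (↑r : Set {j : ι // j ∉ ({e} : Finset ι)})) x ∪
              (if (u ∈ openCluster ((fun j : {j : ι // j ∉ ({e} : Finset ι)} => ends j.1) '' (↑r : Set {j : ι // j ∉ ({e} : Finset ι)})) x ∨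
                   p ∈ openCluster ((fun j : {j : ι // j ∉ ({e} : Finset ι)} => ends j.1) '' (↑r : Set {j : ι // j ∉ ({e} : Finset ι)})) x)
               then (openCluster ((fun j : {j : ι // j ∉ ({e} : Finset ι)} => ends j.1) '' (↑r : Set {j : ι // j ∉ ({e} : Finset ι)})) u ∪
                     openCluster ((fun j : {j : ι // j ∉ ({e} : Finset ι)} => ends j.1) '' (↑r : Set {j : ι // j ∉ ({e} : Finset ι)})) p)
               else (∅ : Set V))) -
          g (openCluster ((fun j : {j : ι // j ∉ ({e} : Finset ι)} => ends j.1) '' (↑(rᶜ) : Set {j : ι // j ∉ ({e} : Finset ι)})) x)))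
      else 0) := by
  classical
  set Pr : ι → Prop := fun j => j ∉ ({e} : Finset ι) with hPr
  set emb := Function.Embedding.subtype Pr with hemb
  set KK : Finset ι → Set V := fun s => openCluster (ends '' (↑s : Set ι)) x with hKK
  set K' : Finset {j : ι // Pr j} → Set V := fun t => openCluster ((fun j : {j : ι // Pr j} => ends j.1) '' (↑t : Set {j : ι // Pr j})) x with hK'
  set U' : Finset {j : ι // Pr j} → Set V := fun t => openCluster ((fun j : {j : ι // Pr j} => ends j.1) '' (↑t : Set {j : ι // Pr j})) u with hU'
  set P' : Finset {j : ι // Pr j} → Set V := fun t => openCluster ((fun j : {j : ι // Pr j} => ends j.1) '' (↑t : Set {j : ι // Pr j})) p with hP'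
  set Kp : Finset {j : ι // Pr j} → Set V := fun t => K' t ∪ (if (u ∈ K' t ∨ p ∈ K' t) then (U' t ∪ P' t) else (∅ : Set V)) with hKp
  -- split at the edge `e`: NO-CORE = 2 × (the `e`-red half)
  have h1 := noCore_split_edge ends x y e
    (fun a b => ((if u ∈ a then (1 : ℝ) else 0) - (if u ∈ b then (1 : ℝ) else 0)) * (g a - g b)) (fun a b => by ring)
  beta_reduce at h1
  rw [h1, sum_filter_mem_eq_sum_subcube e]
  congr 1
  refine Finset.sum_congr rfl fun r _ => ?_
  -- sub-cube bookkeeping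
  have hKT : ∀ t : Finset {j : ι // Pr j}, K' t = KK (t.map emb) := by
    intro t; simp only [hK', hKK, Finset.coe_map, Set.image_image]; rfl
  have hUT : ∀ t : Finset {j : ι // Pr j}, U' t = openCluster (ends '' (↑(t.map emb) : Set ι)) u := by
    intro t; simp only [hU', Finset.coe_map, Set.image_image]; rfl
  have hPT : ∀ t : Finset {j : ι // Pr j}, P' t = openCluster (ends '' (↑(t.map emb) : Set ι)) p := by
    intro t; simp only [hP', Finset.coe_map, Set.image_image]; rfl
  have hcompl : (r.map emb ∪ {e})ᶜ = rᶜ.map emb := by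
    rw [compl_map_union_singleton e r, Finset.sdiff_self, Finset.union_empty]
  have hins : r.map emb ∪ {e} = insert e (r.map emb) := by rw [Finset.union_comm, ← Finset.insert_eq]
  have hKT2 : ∀ t : Finset {j : ι // Pr j}, openCluster (ends '' (↑(t.map emb) : Set ι)) x = K' t := by
    intro t; simp only [hK', Finset.coe_map, Set.image_image]; rfl
  -- the clusters of the two colourings
  have hmem : ∀ v, v ∈ KK (r.map emb ∪ {e}) ↔ v ∈ Kp r := by
    intro v
    rw [hins]
    have h := mem_openCluster_insert_edge_iff ends x (r.map emb) he hup v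
    show v ∈ openCluster (ends '' (↑(insert e (r.map emb)) : Set ι)) x ↔ v ∈ Kp r
    rw [h, hKT2 r, ← hUT r, ← hPT r]
    simp only [hKp, Set.mem_union]
    by_cases hc : (u ∈ K' r ∨ p ∈ K' r)
    · rw [if_pos hc]; simp only [Set.mem_union]
      constructor
      · rintro (hv | ⟨_, hv⟩)
        · exact Or.inl hv
        · exact Or.inr hv
      · rintro (hv | hv)
        · exact Or.inl hv
        · exact Or.inr ⟨hc, hv⟩
    · rw [if_neg hc]
      constructor
      · rintro (hv | ⟨hc', _⟩)
        · exact Or.inl hv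
        · exact absurd hc' hc
      · rintro (hv | hv)
        · exact Or.inl hv
        · exact absurd hv (Set.notMem_empty v)
  have hset : KK (r.map emb ∪ {e}) = Kp r := Set.ext hmem
  have h2 : KK (r.map emb ∪ {e})ᶜ = K' rᶜ := by rw [hcompl, hKT rᶜ]
  change (if ¬ (y ∈ KK (r.map emb ∪ {e}) ∧ y ∈ KK (r.map emb ∪ {e})ᶜ) then
      ((if u ∈ KK (r.map emb ∪ {e}) then (1 : ℝ) else 0) - (if u ∈ KK (r.map emb ∪ {e})ᶜ then (1 : ℝ) else 0)) *
        (g (KK (r.map emb ∪ {e})) - g (KK (r.map emb ∪ {e})ᶜ)) else 0) =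
    (if ¬ (y ∈ Kp r ∧ y ∈ K' rᶜ) then
      ((if u ∈ Kp r then (1 : ℝ) else 0) - (if u ∈ K' rᶜ then (1 : ℝ) else 0)) * (g (Kp r) - g (K' rᶜ)) else 0)
  rw [h2, hset]
  by_cases hc : ¬ (y ∈ Kp r ∧ y ∈ K' rᶜ)
  · rw [if_pos hc, if_pos hc]
    by_cases hu1 : u ∈ Kp r <;> by_cases hu2 : u ∈ K' rᶜ <;> simp only [hu1, hu2, if_true, if_false]
  · rw [if_neg hc, if_neg hc]

end pointEdge

end Coefficientwise

end Summit.CriticalPhenomena.PercolationContinuityZ3.Theorems
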